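import Summits.AtomisticToContinuum.Crystallization.Theorems.ChartedZeroExcessLayeredLatticeLiouvilleZZU

/-!
# Charted zero-excess layered lattices — Part ZZV: rider R2-S «LAYER COVERAGE» proved

Route `ChartedPlanarOrder`, station L2′, lineage `stmt-AtomisticToContinuum-26636`; sequel of Part ZZU (the (B′.5)
skeleton), whose rider `LayerCovered S K Ψ` this part DISCHARGES from three binders the skeleton already carries:
the S-chart `IsBarlowBondChart S Set.univ Ψ τ`, `K.Nonempty`, and local finiteness of the charted sites within `43/2`
of the container (`hfin`).

## Statement (`layerCovered`)

Every chart site `x` with an atom of `K` within `179/16` has, on each of the seven sheets `x.1 + j` (`|j| ≤ 3`), a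
site of the deep window `W′ = window S K Ψ (179/16) (293/16)`.

## Proof (purely combinatorial + local finiteness; no flatness, no steering)

* CLIMB: `(x.1 + j, x.2)` is reached from `x` by `|j| ≤ 3` vertical Barlow steps (`crossAdj_self`: the site straight
  above/below is a cap neighbour), so its image is within `179/16 + 3 · 28/25 < 293/16` of the container.
* WALK: along the in-sheet ray `t ↦ (x.1 + j, x.2 + t · loDir 0)` consecutive sites are Barlow-adjacent, hence bonded,
  so the potential `t ↦ infDist (Ψ ·) K` moves by `≤ 28/25` per step; the ray is injective and the sites charted
  within `43/2` of `K` are finitely many, so the potential eventually exceeds `179/16`; at the FIRST such `t` it lies in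
  `(179/16, 179/16 + 28/25] ⊂ (179/16, 293/16)` (discrete intermediate value), which is membership in `W′`.

0 sorry; standard axioms; no decide, no new definitions of substance (`rayPt` is a local abbreviation, a `def`).
-/

noncomputable section
open Summit.AtomisticToContinuum.Crystallization.Theorems.ChartedPlanarOrderRigidityDoor (E3)

namespace Summit.AtomisticToContinuum.Crystallization.Theorems.ChartedZeroExcessLayeredLatticeLiouville

/-! ### ZZV-1  Vertical and in-sheet unit steps -/

/-- the site straight above is a Barlow neighbour. -/
theorem barlowAdj_up (τ : ℤ → Bool) (z : ℤ × ℤ × ℤ) : BarlowAdj τ z (z.1 + 1, z.2) :=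
  Or.inr (Or.inl ⟨rfl, crossAdj_self _ _⟩)

/-- the site straight below is a Barlow neighbour. -/
theorem barlowAdj_down (τ : ℤ → Bool) (z : ℤ × ℤ × ℤ) : BarlowAdj τ z (z.1 - 1, z.2) :=
  Or.inr (Or.inr ⟨by simp only; omega, crossAdj_self _ _⟩)

/-- the in-sheet ray from `z` in the direction `loDir 0 = (1, 0)`. -/
def rayPt (z : ℤ × ℤ × ℤ) (t : ℕ) : ℤ × ℤ × ℤ := (z.1, (z.2.1 + t, z.2.2))

/-- The ray starts at `z` (lane docstring, hand-2 g39). -/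
theorem rayPt_zero (z : ℤ × ℤ × ℤ) : rayPt z 0 = z := by
  simp [rayPt]

/-- The ray stays on the sheet of `z` (lane docstring, hand-2 g39). -/
theorem rayPt_fst (z : ℤ × ℤ × ℤ) (t : ℕ) : (rayPt z t).1 = z.1 := rfl

/-- The ray is injective in its parameter (lane docstring, hand-2 g39). -/
theorem rayPt_injective (z : ℤ × ℤ × ℤ) : Function.Injective (rayPt z) := by
  intro t t' h
  simp only [rayPt, Prod.mk.injEq] at h
  have := h.2.1
  omega

/-- consecutive ray sites are in-sheet Barlow neighbours. -/
theorem barlowAdj_rayPt (τ : ℤ → Bool) (z : ℤ × ℤ × ℤ) (t : ℕ) :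
    BarlowAdj τ (rayPt z t) (rayPt z (t + 1)) := by
  refine Or.inl ⟨rfl, 0, ?_⟩
  ext
  · simp [rayPt, loDir]; ring
  · simp [rayPt, loDir]

/-- one Barlow step moves chart images by at most a bond length `28/25` (chart on all of `ℤ³`). -/
theorem dist_le_bond_of_barlowAdj {S : Set E3} {Ψ : ℤ × ℤ × ℤ → E3} {τ : ℤ → Bool}
    (hΨ : IsBarlowBondChart S Set.univ Ψ τ) {x z : ℤ × ℤ × ℤ} (h : BarlowAdj τ x z) :
    dist (Ψ x) (Ψ z) ≤ 28 / 25 :=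
  ((hΨ.2.2 x (Set.mem_univ _) z (Set.mem_univ _)).2 h).2

/-- CLIMB: `n` vertical steps up or down cost at most `n · 28/25`. -/
theorem dist_climb_le {S : Set E3} {Ψ : ℤ × ℤ × ℤ → E3} {τ : ℤ → Bool}
    (hΨ : IsBarlowBondChart S Set.univ Ψ τ) (z : ℤ × ℤ × ℤ) (n : ℕ) :
    dist (Ψ z) (Ψ (z.1 + n, z.2)) ≤ n * (28 / 25) ∧ dist (Ψ z) (Ψ (z.1 - n, z.2)) ≤ n * (28 / 25) := by
  induction n with
  | zero => simp
  | succ n ih =>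
    have hu := dist_le_bond_of_barlowAdj hΨ (barlowAdj_up τ (z.1 + n, z.2))
    have hd := dist_le_bond_of_barlowAdj hΨ (barlowAdj_down τ (z.1 - n, z.2))
    simp only at hu hd
    constructor
    · calc dist (Ψ z) (Ψ (z.1 + ↑(n + 1), z.2))
          ≤ dist (Ψ z) (Ψ (z.1 + n, z.2)) + dist (Ψ (z.1 + n, z.2)) (Ψ (z.1 + ↑(n + 1), z.2)) := dist_triangle _ _ _
        _ ≤ n * (28 / 25) + 28 / 25 := by
          have e : (z.1 + ((n + 1 : ℕ) : ℤ), z.2) = (z.1 + n + 1, z.2) := by push_cast; ring_nf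
          rw [e]; exact add_le_add ih.1 hu
        _ = ↑(n + 1) * (28 / 25) := by push_cast; ring
    · calc dist (Ψ z) (Ψ (z.1 - ↑(n + 1), z.2))
          ≤ dist (Ψ z) (Ψ (z.1 - n, z.2)) + dist (Ψ (z.1 - n, z.2)) (Ψ (z.1 - ↑(n + 1), z.2)) := dist_triangle _ _ _
        _ ≤ n * (28 / 25) + 28 / 25 := by
          have e : (z.1 - ((n + 1 : ℕ) : ℤ), z.2) = (z.1 - n - 1, z.2) := by push_cast; ring_nf
          rw [e]; exact add_le_add ih.2 hd
        _ = ↑(n + 1) * (28 / 25) := by push_cast; ring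

/-- CLIMB to a prescribed sheet `x.1 + j`, `|j| ≤ 3`, at cost `≤ 84/25`. -/
theorem dist_sheet_le {S : Set E3} {Ψ : ℤ × ℤ × ℤ → E3} {τ : ℤ → Bool}
    (hΨ : IsBarlowBondChart S Set.univ Ψ τ) (x : ℤ × ℤ × ℤ) {j : ℤ} (hj1 : -3 ≤ j) (hj2 : j ≤ 3) :
    dist (Ψ x) (Ψ (x.1 + j, x.2)) ≤ 84 / 25 := by
  have hn : (j.natAbs : ℝ) ≤ 3 := by
    have : (j.natAbs : ℤ) ≤ 3 := by omega
    exact_mod_cast this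
  rcases Int.natAbs_eq j with h | h
  · have := (dist_climb_le hΨ x j.natAbs).1
    rw [← h] at this
    linarith
  · have := (dist_climb_le hΨ x j.natAbs).2
    rw [show x.1 - (j.natAbs : ℤ) = x.1 + j by omega] at this
    linarith

/-! ### ZZV-2  ★ The rider -/

/-- ★ RIDER R2-S «LAYER COVERAGE» holds for every bond chart of `S` on `ℤ³` as soon as `K` is non-empty and the sites
charted within `43/2` of `K` are finitely many. -/
theorem layerCovered {S K : Set E3} {Ψ : ℤ × ℤ × ℤ → E3} {τ : ℤ → Bool}
    (hΨ : IsBarlowBondChart S Set.univ Ψ τ) (hKne : K.Nonempty)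
    (hfin : Set.Finite {x : ℤ × ℤ × ℤ | ∃ k ∈ K, dist (Ψ x) k ≤ 43 / 2}) : LayerCovered S K Ψ := by
  classical
  intro x hx j hj1 hj2
  obtain ⟨k, hk, hxk⟩ := hx
  obtain ⟨z₀, hz₀1, hz₀k⟩ : ∃ z₀ : ℤ × ℤ × ℤ, z₀.1 = x.1 + j ∧ dist (Ψ z₀) k ≤ 179 / 16 + 84 / 25 := by
    refine ⟨(x.1 + j, x.2), rfl, ?_⟩
    have := dist_sheet_le hΨ x hj1 hj2
    linarith [dist_triangle (Ψ (x.1 + j, x.2)) (Ψ x) k, dist_comm (Ψ x) (Ψ (x.1 + j, x.2))]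
  -- the potential `t ↦ infDist (Ψ (rayPt z₀ t)) K` moves by at most a bond length per step
  have hstep : ∀ t, Metric.infDist (Ψ (rayPt z₀ (t + 1))) K ≤ Metric.infDist (Ψ (rayPt z₀ t)) K + 28 / 25 := by
    intro t
    have h1 := dist_le_bond_of_barlowAdj hΨ (barlowAdj_rayPt τ z₀ t)
    rw [dist_comm] at h1
    have h2 := Metric.infDist_le_infDist_add_dist (s := K) (x := Ψ (rayPt z₀ (t + 1))) (y := Ψ (rayPt z₀ t))
    linarith
  -- membership in `W′` read off the potential
  have hmem : ∀ t, 179 / 16 < Metric.infDist (Ψ (rayPt z₀ t)) K → Metric.infDist (Ψ (rayPt z₀ t)) K < 293 / 16 →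
      rayPt z₀ t ∈ window S K Ψ (179 / 16) (293 / 16) := fun t h1 h2 =>
    ⟨hΨ.2.1 (Set.mem_univ _), (Metric.infDist_lt_iff hKne).1 h2,
      fun y hy => lt_of_lt_of_le h1 (Metric.infDist_le_dist_of_mem hy)⟩
  -- the potential eventually exceeds `179/16` (the ray is infinite, the charted ball finite)
  have hex : ∃ t, 179 / 16 < Metric.infDist (Ψ (rayPt z₀ t)) K := by
    by_contra hcon
    push Not at hcon
    have hsub : Set.range (rayPt z₀) ⊆ {x : ℤ × ℤ × ℤ | ∃ k ∈ K, dist (Ψ x) k ≤ 43 / 2} := by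
      rintro _ ⟨t, rfl⟩
      have hlt : Metric.infDist (Ψ (rayPt z₀ t)) K < 43 / 2 := by linarith [hcon t]
      obtain ⟨y, hy, hyd⟩ := (Metric.infDist_lt_iff hKne).1 hlt
      exact ⟨y, hy, hyd.le⟩
    exact Set.infinite_range_of_injective (rayPt_injective z₀) (hfin.subset hsub)
  -- the FIRST exceedance lands in the window (discrete intermediate value)
  obtain ⟨t₀, ht₀, hmin⟩ : ∃ t₀, 179 / 16 < Metric.infDist (Ψ (rayPt z₀ t₀)) K ∧
      ∀ t < t₀, ¬ 179 / 16 < Metric.infDist (Ψ (rayPt z₀ t)) K :=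
    ⟨Nat.find hex, Nat.find_spec hex, fun t ht => Nat.find_min hex ht⟩
  have hf0 : Metric.infDist (Ψ (rayPt z₀ 0)) K ≤ 179 / 16 + 84 / 25 := by
    rw [rayPt_zero]
    exact (Metric.infDist_le_dist_of_mem hk).trans hz₀k
  have hup : Metric.infDist (Ψ (rayPt z₀ t₀)) K < 293 / 16 := by
    rcases Nat.eq_zero_or_pos t₀ with h0 | hpos
    · rw [h0]; linarith
    · have hprev := hmin (t₀ - 1) (by omega)
      have := hstep (t₀ - 1)
      rw [Nat.sub_add_cancel hpos] at this
      push Not at hprev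
      linarith
  exact ⟨rayPt z₀ t₀, hmem t₀ ht₀ hup, by rw [rayPt_fst, hz₀1]⟩

/-- the record instance in the binder shape of `slabIso_package`. -/
theorem layerCovered_record {S K : Set E3} {Ψ : ℤ × ℤ × ℤ → E3} {τ : ℤ → Bool}
    (hΨ : IsBarlowBondChart S Set.univ Ψ τ) (hKne : K.Nonempty)
    (hfin : Set.Finite {x : ℤ × ℤ × ℤ | ∃ k ∈ K, dist (Ψ x) k ≤ 43 / 2}) : LayerCovered S K Ψ :=
  layerCovered hΨ hKne hfin

end Summit.AtomisticToContinuum.Crystallization.Theorems.ChartedZeroExcessLayeredLatticeLiouville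

end
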